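import Mathlib
import Literature.NumberTheory.LFunctions.Zhang2022.TypedSection12A
import Literature.NumberTheory.LFunctions.Zhang2022.Section11LeavesEps
import HarnessLib

/-!
# Zhang (2022) §12 p. 67, the approximate functional equation for `H̃₁₅` — I: the window of `H̃₁₅`,
# the definition of `ϰ₁₂` unfolded, and the Gaussian tails (4.2)/(4.3)

Topic `Literature/NumberTheory/LFunctions/Zhang2022` (Landau–Siegel audit tree; verdict-neutral).
Y. Zhang, *Discrete mean estimates and the Landau–Siegel zero*, arXiv:2211.02515v1 (2022)
[Zhang2022LandauSiegel] — **an unrefereed manuscript under adjudication; nothing here asserts or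
denies its Theorems 1–2.** ZHANG-L lane (WP12, helper H2 under the leaf hXi `Typed.Sec12A.Xi15Hbar16`,
row G-d42-3); companion of `Section12Htilde15AFE` (the node `Z22:§12.u009` itself).

Node `Z22:§12.u009` (§12 p. 67, tex L3426–L3429; `Typed.Sec12A.Htilde15ApproxFE`): "Using the proof of
Lemma 11.2 with `s + β₆` in place of `s` we deduce that `H̃₁₅(s,ψ) = (Z(s+β₆,ψχ)P₁^{β₆}/0.504)
Σ_n χψ̄(n)n^{−(1−s−β₆)}∫_{0.496}^{0.5}{g(P^{0.5}Dt₀/n) − g(P^zDt₀/n)}dz + O(E(s+β₆,ψ))`." This file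
supplies the two elementary inputs of that deduction:

* `Htilde15_eq_integral` — **`H̃₁₅(s,ψ) = (P₁^{β₆}/0.504)∫_{0.5}^{0.504} Σ_{P^{0.5}η₋<n<P₁η₊}
  χψ(n)n^{−(s+β₆)}{g(P^z/n) − g(P^{0.5}/n)}dz`** — the definition of `ϰ₁₂` (§12 p. 66, tex L3386:
  `ϰ₁₂(y) = (1/0.504)(P₁/y)^{β₆}∫_{0.5}^{0.504}{g(P^z/y) − g(P^{0.5}/y)}dz`), `(P₁/n)^{β₆} =
  P₁^{β₆}n^{−β₆}`, and the interchange of the finite window sum with the `z`-integral;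
* `norm_winSum_sub_tsum_le` — **completing the window sum to the full series costs `≤ 2e^{−𝓛¹⁰/2}`**,
  uniformly in `z ∈ [0.5, 0.504]` on `σ = 1/2`: for `n ≤ P^{0.5}η₋` both `g(P^z/n)`, `g(P^{0.5}/n)` are
  within `½e^{−𝓛¹⁰}` of `1` ((4.2), `Section11GaussTails.abs_gW_sub_one_le`), for `n ≥ P₁η₊` both are
  `≤ ½e^{−𝓛²⁰(log n − 0.504𝓛⁹)}` ((4.3), `Section11GaussTails.gW_le_exp`); summable majorant
  `e^{−𝓛¹⁰/2}n⁻²` exactly as in `Typed.Sec11A.tails_bound` (§11 p. 63).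

Theorem-only (the window `Finset` of `Typed.Sec12A.Htilde15` and the summands are written out verbatim,
no abbreviations); 0 definitions, 0 claims, 0 facts; standard axioms.

## References

* Y. Zhang, arXiv:2211.02515v1 (2022), §12 pp. 66–67 (tex L3386–L3390, L3426–L3434); §11 p. 63;
  §4 (4.1)–(4.3). [cite: Zhang2022LandauSiegel, §12 pp. 66–67]
-/

noncomputable section

open Complex Real ComplexConjugate MeasureTheory Set

namespace Literature.NumberTheory.LFunctions.Zhang2022.Section12Htilde15AFE

open Literature.NumberTheory.LFunctions.Zhang2022.Skeleton
open Literature.NumberTheory.LFunctions.Zhang2022.Typed.Sec12A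
open Literature.NumberTheory.LFunctions.Zhang2022.GaussTails

variable {D : ℕ}

/-! ## §0. The shift `s ↦ s + β₆` and the parameters -/

/-- `Re(s + β₆) = Re s` (`β₆ = 3iα/2` is purely imaginary). [cite: Zhang2022LandauSiegel, §8 (8.6)] -/
theorem add_beta6_re (s : ℂ) : (s + beta6 D).re = s.re := by
  rw [Complex.add_re, beta6_re, add_zero]

/-- `Im(s + β₆) = Im s + 3α/2`. [cite: Zhang2022LandauSiegel, §8 (8.6)] -/
theorem add_beta6_im (s : ℂ) : (s + beta6 D).im = s.im + 3 / 2 * alpha D := by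
  simp [beta6, Complex.mul_im, Complex.mul_re, Complex.div_ofNat_im]
  ring

/-- `3α/2 ≤ 1` once `𝓛 ≥ 2`. [cite: Zhang2022LandauSiegel, §2 (2.10)] -/
theorem three_halves_alpha_le_one (hL : 2 ≤ ell D) : 3 / 2 * alpha D ≤ 1 ∧ 0 ≤ alpha D := by
  rw [Section2.alpha_eq_pi_div_ell9]
  have h9 : (2 : ℝ) ^ 9 ≤ ell D ^ 9 := pow_le_pow_left₀ (by norm_num) hL 9
  have hpos : 0 < ell D ^ 9 := lt_of_lt_of_le (by norm_num) h9
  refine ⟨?_, div_nonneg Real.pi_pos.le hpos.le⟩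
  rw [mul_div_assoc', div_le_one hpos]
  nlinarith [Real.pi_lt_d2]

/-- `P₁ = P^{0.504}`, `log P₁ = 0.504𝓛⁹`, `P₁ > 0`. [cite: Zhang2022LandauSiegel, §2 (2.21)] -/
theorem P1_eq (D : ℕ) : Skeleton.P1 D = bigP D ^ (0.504 : ℝ) := rfl

/-- `P₁ > 0`. [cite: Zhang2022LandauSiegel, §2 (2.21)] -/
theorem P1_pos (D : ℕ) : 0 < Skeleton.P1 D := Real.rpow_pos_of_pos (bigP_pos' D) _

/-! ## §1. The window and the definition of `ϰ₁₂` unfolded -/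

/-- Members of the window of `H̃₁₅` (the integers `P^{0.5}η₋ < n < P₁η₊`, as in
`Typed.Sec12A.Htilde15`) are `≥ 1`. [cite: Zhang2022LandauSiegel, §12 p. 66] -/
theorem one_le_of_mem_win {n : ℕ}
    (hn : n ∈ (Finset.Ico 1 ⌈Skeleton.P1 D * etaPM D 1⌉₊).filter
        (fun n : ℕ => bigP D ^ (0.5 : ℝ) * etaPM D (-1) < n ∧ (n : ℝ) < Skeleton.P1 D * etaPM D 1)) :
    1 ≤ n :=
  (Finset.mem_Ico.mp (Finset.mem_filter.mp hn).1).1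

/-- An integer `n ≥ 1` outside the window is `≤ P^{0.5}η₋` or `≥ P₁η₊`.
[cite: Zhang2022LandauSiegel, §12 p. 67] -/
theorem le_or_le_of_not_mem_win {n : ℕ} (hn1 : 1 ≤ n)
    (hn : n ∉ (Finset.Ico 1 ⌈Skeleton.P1 D * etaPM D 1⌉₊).filter
        (fun n : ℕ => bigP D ^ (0.5 : ℝ) * etaPM D (-1) < n ∧ (n : ℝ) < Skeleton.P1 D * etaPM D 1)) :
    (n : ℝ) ≤ bigP D ^ (0.5 : ℝ) * etaPM D (-1) ∨ Skeleton.P1 D * etaPM D 1 ≤ n := by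
  rw [Finset.mem_filter, Finset.mem_Ico, not_and_or, not_and_or, not_and_or, not_lt, not_lt,
    not_le] at hn
  rcases hn with (h | h) | h | h
  · omega
  · right; exact Nat.ceil_le.mp h
  · left; exact h
  · right; exact not_lt.mp h

variable [NeZero D] (χ : DirichletCharacter ℂ D) (x : Chr D)

omit [NeZero D] in
/-- The summand `χψ(n)n^{−(s+β₆)}{g(P^z/n) − g(P^{0.5}/n)}` is the difference of the terms
`χψ(n)n^{−(s+β₆)}g(P^z/n)` and `χψ(n)n^{−(s+β₆)}g(P^{0.5}/n)` of the smoothed sums of Lemma 11.2.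
[cite: Zhang2022LandauSiegel, §12 p. 66] -/
theorem dTerm_eq_sub (s : ℂ) (z : ℝ) (n : ℕ) :
    pc χ x n * (n : ℂ) ^ (-(s + beta6 D)) *
        ((gW D (bigP D ^ z / (n : ℝ)) - gW D (bigP D ^ (0.5 : ℝ) / (n : ℝ)) : ℝ) : ℂ) =
      pc χ x n * (n : ℂ) ^ (-(s + beta6 D)) * (gW D (bigP D ^ z / (n : ℝ)) : ℂ) -
        pc χ x n * (n : ℂ) ^ (-(s + beta6 D)) * (gW D (bigP D ^ (0.5 : ℝ) / (n : ℝ)) : ℂ) := by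
  push_cast
  ring

omit [NeZero D] in
/-- `(P₁/n)^{β₆} = P₁^{β₆}·n^{−β₆}` (`n ≥ 1`). [cite: Zhang2022LandauSiegel, §12 p. 66] -/
theorem P1_div_cpow {n : ℕ} (hn : 1 ≤ n) :
    ((Skeleton.P1 D / n : ℝ) : ℂ) ^ beta6 D =
      ((Skeleton.P1 D : ℝ) : ℂ) ^ beta6 D * (n : ℂ) ^ (-beta6 D) := by
  have hn0 : (0 : ℝ) < n := by exact_mod_cast hn
  have hP : 0 ≤ Skeleton.P1 D := (P1_pos D).le
  have e1 : ((Skeleton.P1 D / n : ℝ) : ℂ) = ((Skeleton.P1 D : ℝ) : ℂ) * (((n : ℝ)⁻¹ : ℝ) : ℂ) := by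
    push_cast; ring
  rw [e1, Complex.mul_cpow_ofReal_nonneg hP (inv_nonneg.mpr hn0.le)]
  congr 1
  have harg : ((n : ℝ) : ℂ).arg ≠ π := by
    rw [Complex.arg_ofReal_of_nonneg hn0.le]; exact Real.pi_pos.ne
  rw [Complex.ofReal_inv, Complex.inv_cpow _ _ harg, Complex.cpow_neg]
  norm_cast

omit [NeZero D] in
/-- Continuity of `z ↦ χψ(n)n^{−(s+β₆)}{g(P^z/n) − g(P^{0.5}/n)}`. [cite: Zhang2022LandauSiegel, §12 p. 66] -/
theorem continuous_dTerm (hD : 2 ≤ D) (s : ℂ) (n : ℕ) :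
    Continuous fun z : ℝ => pc χ x n * (n : ℂ) ^ (-(s + beta6 D)) *
      ((gW D (bigP D ^ z / (n : ℝ)) - gW D (bigP D ^ (0.5 : ℝ) / (n : ℝ)) : ℝ) : ℂ) := by
  have h1 := Section11Deductions.continuous_fTerm χ x hD (s + beta6 D) n
  have h2 : Continuous fun _ : ℝ =>
      pc χ x n * (n : ℂ) ^ (-(s + beta6 D)) * (gW D (bigP D ^ (0.5 : ℝ) / (n : ℝ)) : ℂ) :=
    continuous_const
  simp only [dTerm_eq_sub]
  exact h1.sub h2

omit [NeZero D] in
/-- **`H̃₁₅(s,ψ) = (P₁^{β₆}/0.504)·∫_{0.5}^{0.504} Σ_{n in the window} χψ(n)n^{−(s+β₆)}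
{g(P^z/n) − g(P^{0.5}/n)} dz`** — the definition of `ϰ₁₂` ((P₁/n)^{β₆} = P₁^{β₆}n^{−β₆}`,
`n^{−s}n^{−β₆} = n^{−(s+β₆)}`) and the interchange of the finite sum with the `z`-integral.
[cite: Zhang2022LandauSiegel, §12 p. 66, tex L3386–L3390] -/
theorem Htilde15_eq_integral (hD : 2 ≤ D) (s : ℂ) :
    Htilde15 χ x s = ((1 / 0.504 : ℝ) : ℂ) * ((Skeleton.P1 D : ℂ) ^ beta6 D) *
      ∫ z in (0.5 : ℝ)..0.504, ∑ n ∈ (Finset.Ico 1 ⌈Skeleton.P1 D * etaPM D 1⌉₊).filter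
        (fun n : ℕ => bigP D ^ (0.5 : ℝ) * etaPM D (-1) < n ∧ (n : ℝ) < Skeleton.P1 D * etaPM D 1),
        pc χ x n * (n : ℂ) ^ (-(s + beta6 D)) *
          ((gW D (bigP D ^ z / (n : ℝ)) - gW D (bigP D ^ (0.5 : ℝ) / (n : ℝ)) : ℝ) : ℂ) := by
  have hterm : ∀ n ∈ (Finset.Ico 1 ⌈Skeleton.P1 D * etaPM D 1⌉₊).filter
      (fun n : ℕ => bigP D ^ (0.5 : ℝ) * etaPM D (-1) < n ∧ (n : ℝ) < Skeleton.P1 D * etaPM D 1),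
      vk12 D n * pc χ x n * (n : ℂ) ^ (-s) =
      ((1 / 0.504 : ℝ) : ℂ) * ((Skeleton.P1 D : ℂ) ^ beta6 D) *
        ∫ z in (0.5 : ℝ)..0.504, pc χ x n * (n : ℂ) ^ (-(s + beta6 D)) *
          ((gW D (bigP D ^ z / (n : ℝ)) - gW D (bigP D ^ (0.5 : ℝ) / (n : ℝ)) : ℝ) : ℂ) := by
    intro n hn
    have hn1 : 1 ≤ n := one_le_of_mem_win hn
    have hn0 : (n : ℂ) ≠ 0 := by exact_mod_cast (by omega : n ≠ 0)
    have hcpow : (n : ℂ) ^ (-(s + beta6 D)) = (n : ℂ) ^ (-s) * (n : ℂ) ^ (-beta6 D) := by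
      rw [neg_add, Complex.cpow_add _ _ hn0]
    rw [intervalIntegral.integral_const_mul, intervalIntegral.integral_ofReal, vk12, P1_div_cpow hn1,
      hcpow]
    ring
  rw [Htilde15, Finset.sum_congr rfl hterm, ← Finset.mul_sum, intervalIntegral.integral_finsetSum]
  intro n _
  exact (continuous_dTerm χ x hD s n).intervalIntegrable _ _

/-! ## §2. Completing the window sum to the series: the Gaussian tails -/

omit [NeZero D] in
/-- **Head**: for `1 ≤ n ≤ P^{0.5}η₋` and `z ≥ 0.5`, `|g(P^z/n) − g(P^{0.5}/n)| ≤ e^{−𝓛¹⁰}` — both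
values are within `½e^{−𝓛¹⁰}` of `1` by (4.2). [cite: Zhang2022LandauSiegel, §4 (4.2); §12 p. 67] -/
theorem abs_gW_diff_le_head (hL : 0 < ell D) {n : ℕ} (hn : 1 ≤ n)
    (hhead : (n : ℝ) ≤ bigP D ^ (0.5 : ℝ) * etaPM D (-1)) {z : ℝ} (hz : 0.5 ≤ z) :
    |gW D (bigP D ^ z / (n : ℝ)) - gW D (bigP D ^ (0.5 : ℝ) / (n : ℝ))| ≤ Real.exp (-ell D ^ 10) := by
  have hn0 : (0 : ℝ) < n := by exact_mod_cast hn
  have hlogn : Real.log n ≤ 0.5 * ell D ^ 9 - (ell D ^ 10)⁻¹ := by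
    have h1 := Real.log_le_log hn0 hhead
    rw [log_rpow_mul_etaPM] at h1
    linarith
  have h9 : 0 < ell D ^ 9 := pow_pos hL 9
  have hz' : (ell D ^ 10)⁻¹ ≤ z * ell D ^ 9 - Real.log n := by nlinarith
  have h5' : (ell D ^ 10)⁻¹ ≤ 0.5 * ell D ^ 9 - Real.log n := by linarith
  have ha := abs_gW_sub_one_le hL hn0 hz'
  have hb := abs_gW_sub_one_le hL hn0 h5'
  calc |gW D (bigP D ^ z / (n : ℝ)) - gW D (bigP D ^ (0.5 : ℝ) / (n : ℝ))|
      = |(gW D (bigP D ^ z / (n : ℝ)) - 1) - (gW D (bigP D ^ (0.5 : ℝ) / (n : ℝ)) - 1)| := by ring_nf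
    _ ≤ |gW D (bigP D ^ z / (n : ℝ)) - 1| + |gW D (bigP D ^ (0.5 : ℝ) / (n : ℝ)) - 1| :=
        abs_sub _ _
    _ ≤ 1 / 2 * Real.exp (-ell D ^ 10) + 1 / 2 * Real.exp (-ell D ^ 10) := add_le_add ha hb
    _ = Real.exp (-ell D ^ 10) := by ring

omit [NeZero D] in
/-- **Tail**: for `n ≥ P₁η₊` and `0.5 ≤ z ≤ 0.504`, `|g(P^z/n) − g(P^{0.5}/n)| ≤ e^{−𝓛²⁰(log n − 0.504𝓛⁹)}`
— both values lie in `[0, ½e^{−𝓛²⁰u}]` by (4.3). [cite: Zhang2022LandauSiegel, §4 (4.3); §12 p. 67] -/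
theorem abs_gW_diff_le_tail (hL : 0 < ell D) {n : ℕ} (htail : Skeleton.P1 D * etaPM D 1 ≤ n)
    {z : ℝ} (hz2 : z ≤ 0.504) :
    |gW D (bigP D ^ z / (n : ℝ)) - gW D (bigP D ^ (0.5 : ℝ) / (n : ℝ))| ≤
      Real.exp (-(ell D ^ 20 * (Real.log n - 0.504 * ell D ^ 9))) := by
  rw [P1_eq] at htail
  have hn0 : (0 : ℝ) < n := lt_of_lt_of_le (rpow_mul_etaPM_pos D _ _) htail
  have hlogn : 0.504 * ell D ^ 9 + (ell D ^ 10)⁻¹ ≤ Real.log n := by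
    have h1 := Real.log_le_log (rpow_mul_etaPM_pos D _ _) htail
    rw [log_rpow_mul_etaPM] at h1
    linarith
  set u : ℝ := Real.log n - 0.504 * ell D ^ 9 with hu_def
  have hu : (ell D ^ 10)⁻¹ ≤ u := by rw [hu_def]; linarith
  have h9 : 0 < ell D ^ 9 := pow_pos hL 9
  have hza : z * ell D ^ 9 - Real.log n ≤ -u := by rw [hu_def]; nlinarith
  have hzb : 0.5 * ell D ^ 9 - Real.log n ≤ -u := by rw [hu_def]; nlinarith
  obtain ⟨ha0, ha⟩ := gW_le_exp hL hn0 hu hza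
  obtain ⟨hb0, hb⟩ := gW_le_exp hL hn0 hu hzb
  rw [abs_le]
  constructor <;> nlinarith [Real.exp_pos (-(ell D ^ 20 * u))]

omit [NeZero D] in
/-- **The summable majorant off the window**: for `n ≥ 1` outside the window, `0.5 ≤ z ≤ 0.504`,
`σ = 1/2` and `𝓛 ≥ 5`, `|χψ(n)n^{−(s+β₆)}{g(P^z/n) − g(P^{0.5}/n)}| ≤ e^{−𝓛¹⁰/2}·n⁻²` (head: `e^{−𝓛¹⁰}n²
≤ e^{−𝓛¹⁰/2}`; tail: `e^{−𝓛²⁰u}n² ≤ e^{−𝓛¹⁰/2}`, `Section11GaussTails.head/tail_exponent_le`).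
[cite: Zhang2022LandauSiegel, §12 p. 67; §4 (4.2)–(4.3)] -/
theorem norm_dTerm_le_off_window (hL5 : 5 ≤ ell D) {s : ℂ} (hs : s.re = 1 / 2) {n : ℕ}
    (hn : 1 ≤ n)
    (hoff : n ∉ (Finset.Ico 1 ⌈Skeleton.P1 D * etaPM D 1⌉₊).filter
        (fun n : ℕ => bigP D ^ (0.5 : ℝ) * etaPM D (-1) < n ∧ (n : ℝ) < Skeleton.P1 D * etaPM D 1))
    {z : ℝ} (hz1 : 0.5 ≤ z) (hz2 : z ≤ 0.504) :
    ‖pc χ x n * (n : ℂ) ^ (-(s + beta6 D)) *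
        ((gW D (bigP D ^ z / (n : ℝ)) - gW D (bigP D ^ (0.5 : ℝ) / (n : ℝ)) : ℝ) : ℂ)‖ ≤
      Real.exp (-(ell D ^ 10 / 2)) * (1 / (n : ℝ) ^ 2) := by
  have hL : 0 < ell D := by linarith
  set L : ℝ := ell D with hLdef
  have hn0 : (0 : ℝ) < n := by exact_mod_cast hn
  have hcpow : ‖(n : ℂ) ^ (-(s + beta6 D))‖ ≤ 1 := by
    rw [Complex.norm_natCast_cpow_of_pos hn, Complex.neg_re, add_beta6_re, hs]
    exact Real.rpow_le_one_of_one_le_of_nonpos (by exact_mod_cast hn) (by norm_num)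
  have h9 : (0.504 : ℝ) * L ^ 9 ≤ L ^ 9 := by nlinarith [pow_pos hL 9]
  have hw : |gW D (bigP D ^ z / (n : ℝ)) - gW D (bigP D ^ (0.5 : ℝ) / (n : ℝ))| ≤
      Real.exp (-(L ^ 10 / 2)) * (1 / (n : ℝ) ^ 2) := by
    rw [mul_one_div, le_div_iff₀ (by positivity), natCast_sq_eq_exp hn]
    rcases le_or_le_of_not_mem_win hn hoff with hhead | htail
    · have h := abs_gW_diff_le_head hL hn hhead hz1
      have hlog : Real.log n ≤ 0.5 * L ^ 9 := by
        have h1 := Real.log_le_log hn0 hhead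
        rw [log_rpow_mul_etaPM] at h1
        nlinarith [inv_pos.mpr (pow_pos hL 10)]
      calc |gW D (bigP D ^ z / (n : ℝ)) - gW D (bigP D ^ (0.5 : ℝ) / (n : ℝ))| *
            Real.exp (2 * Real.log n)
          ≤ Real.exp (-L ^ 10) * Real.exp (2 * Real.log n) := by gcongr
        _ = Real.exp (-L ^ 10 + 2 * Real.log n) := (Real.exp_add _ _).symm
        _ ≤ Real.exp (-(L ^ 10 / 2)) :=
            Real.exp_le_exp.mpr (head_exponent_le hL5 (by nlinarith [pow_pos hL 9]) hlog)
    · have h := abs_gW_diff_le_tail hL htail hz2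
      have hlog : 0.504 * L ^ 9 + (L ^ 10)⁻¹ ≤ Real.log n := by
        rw [P1_eq] at htail
        have h1 := Real.log_le_log (rpow_mul_etaPM_pos D _ _) htail
        rw [log_rpow_mul_etaPM] at h1
        linarith
      calc |gW D (bigP D ^ z / (n : ℝ)) - gW D (bigP D ^ (0.5 : ℝ) / (n : ℝ))| *
            Real.exp (2 * Real.log n)
          ≤ Real.exp (-(L ^ 20 * (Real.log n - 0.504 * L ^ 9))) * Real.exp (2 * Real.log n) := by
            gcongr
        _ = Real.exp (-(L ^ 20 * (Real.log n - 0.504 * L ^ 9)) + 2 * Real.log n) :=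
            (Real.exp_add _ _).symm
        _ ≤ Real.exp (-(L ^ 10 / 2)) := Real.exp_le_exp.mpr (tail_exponent_le hL5 h9 hlog)
  calc ‖pc χ x n * (n : ℂ) ^ (-(s + beta6 D)) *
        ((gW D (bigP D ^ z / (n : ℝ)) - gW D (bigP D ^ (0.5 : ℝ) / (n : ℝ)) : ℝ) : ℂ)‖
      = ‖pc χ x n‖ * ‖(n : ℂ) ^ (-(s + beta6 D))‖ *
          |gW D (bigP D ^ z / (n : ℝ)) - gW D (bigP D ^ (0.5 : ℝ) / (n : ℝ))| := by
        rw [norm_mul, norm_mul, Complex.norm_real, Real.norm_eq_abs]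
    _ ≤ 1 * 1 * (Real.exp (-(L ^ 10 / 2)) * (1 / (n : ℝ) ^ 2)) := by
        gcongr
        rw [pc, norm_mul]
        exact mul_le_one₀ (DirichletCharacter.norm_le_one _ _) (norm_nonneg _)
          (DirichletCharacter.norm_le_one _ _)
    _ = Real.exp (-(L ^ 10 / 2)) * (1 / (n : ℝ) ^ 2) := by ring

/-! ## §3. Completing the window sum to the series -/

omit [NeZero D] in
/-- Summability of `n ↦ χψ(n)n^{−w}g(P^z/n)` for `Re w = 1/2`, `z ≤ 0.504` (majorant `2P^{0.504}n^{−3/2}`,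
`Section11Deductions.norm_fTerm_le`). [cite: Zhang2022LandauSiegel, §11 p. 65] -/
theorem summable_fTerm (hD : 3 ≤ D) {w : ℂ} (hw : w.re = 1 / 2) {z : ℝ} (hz : z ≤ 0.504) :
    Summable fun n : ℕ => pc χ x n * (n : ℂ) ^ (-w) * (gW D (bigP D ^ z / (n : ℝ)) : ℂ) := by
  have hM : Summable fun n : ℕ => 2 * bigP D ^ (0.504 : ℝ) / (n : ℝ) ^ (3 / 2 : ℝ) := by
    have h := (Real.summable_one_div_nat_rpow.mpr (by norm_num : (1 : ℝ) < 3 / 2)).mul_left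
      (2 * bigP D ^ (0.504 : ℝ))
    refine h.congr fun n => ?_
    rw [mul_one_div]
  exact Summable.of_norm_bounded hM fun n => Section11Deductions.norm_fTerm_le χ x hD hw n hz

omit [NeZero D] in
/-- `Σ_nχψ(n)n^{−(s+β₆)}g(P^z/n) − Σ_nχψ(n)n^{−(s+β₆)}g(P^{0.5}/n) = Σ_n dTerm` (both series converge
absolutely on `σ = 1/2`). [cite: Zhang2022LandauSiegel, §12 p. 67] -/
theorem tsum_sub_eq_tsum_dTerm (hD : 3 ≤ D) {s : ℂ} (hs : s.re = 1 / 2) {z : ℝ} (hz : z ≤ 0.504) :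
    (∑' n : ℕ, pc χ x n * (n : ℂ) ^ (-(s + beta6 D)) * (gW D (bigP D ^ z / (n : ℝ)) : ℂ)) -
        (∑' n : ℕ, pc χ x n * (n : ℂ) ^ (-(s + beta6 D)) * (gW D (bigP D ^ (0.5 : ℝ) / (n : ℝ)) : ℂ)) =
      ∑' n : ℕ, pc χ x n * (n : ℂ) ^ (-(s + beta6 D)) *
        ((gW D (bigP D ^ z / (n : ℝ)) - gW D (bigP D ^ (0.5 : ℝ) / (n : ℝ)) : ℝ) : ℂ) := by
  have hw : (s + beta6 D).re = 1 / 2 := by rw [add_beta6_re, hs]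
  have h1 := summable_fTerm χ x hD hw hz
  have h2 := summable_fTerm χ x hD hw (z := 0.5) (by norm_num)
  rw [← h1.tsum_sub h2]
  exact tsum_congr fun n => (dTerm_eq_sub χ x s z n).symm

omit [NeZero D] in
/-- Summability of `n ↦ dTerm(s,z,n)` (`σ = 1/2`, `z ≤ 0.504`). [cite: Zhang2022LandauSiegel, §12 p. 67] -/
theorem summable_dTerm (hD : 3 ≤ D) {s : ℂ} (hs : s.re = 1 / 2) {z : ℝ} (hz : z ≤ 0.504) :
    Summable fun n : ℕ => pc χ x n * (n : ℂ) ^ (-(s + beta6 D)) *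
      ((gW D (bigP D ^ z / (n : ℝ)) - gW D (bigP D ^ (0.5 : ℝ) / (n : ℝ)) : ℝ) : ℂ) := by
  have hw : (s + beta6 D).re = 1 / 2 := by rw [add_beta6_re, hs]
  have h := (summable_fTerm χ x hD hw hz).sub (summable_fTerm χ x hD hw (z := 0.5) (by norm_num))
  exact h.congr fun n => (dTerm_eq_sub χ x s z n).symm

omit [NeZero D] in
/-- **The terms outside the window contribute `≤ 2e^{−𝓛¹⁰/2}`** ("By (4.2) and (4.3), the terms with
`n ≤ P^{0.5}η₋` or `n ≥ P₁η₊ …`" — the analogue of §11 p. 63 / §12 p. 67 for the window of `H̃₁₅`):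
`‖Σ_{n in window} dTerm − Σ_n dTerm‖ ≤ 2e^{−𝓛¹⁰/2}`, uniformly in `0.5 ≤ z ≤ 0.504`, for `σ = 1/2`,
`D ≥ ⌈e⁵⌉`. [cite: Zhang2022LandauSiegel, §12 p. 67; §4 (4.2)–(4.3)] -/
theorem norm_winSum_sub_tsum_le (hD5 : ⌈Real.exp 5⌉₊ ≤ D) (hD : 3 ≤ D) {s : ℂ} (hs : s.re = 1 / 2)
    {z : ℝ} (hz1 : 0.5 ≤ z) (hz2 : z ≤ 0.504) :
    ‖(∑ n ∈ (Finset.Ico 1 ⌈Skeleton.P1 D * etaPM D 1⌉₊).filter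
        (fun n : ℕ => bigP D ^ (0.5 : ℝ) * etaPM D (-1) < n ∧ (n : ℝ) < Skeleton.P1 D * etaPM D 1),
        pc χ x n * (n : ℂ) ^ (-(s + beta6 D)) *
          ((gW D (bigP D ^ z / (n : ℝ)) - gW D (bigP D ^ (0.5 : ℝ) / (n : ℝ)) : ℝ) : ℂ)) -
        ∑' n : ℕ, pc χ x n * (n : ℂ) ^ (-(s + beta6 D)) *
          ((gW D (bigP D ^ z / (n : ℝ)) - gW D (bigP D ^ (0.5 : ℝ) / (n : ℝ)) : ℝ) : ℂ)‖ ≤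
      2 * Real.exp (-(1 / 2) * ell D ^ 10) := by
  have hL5 : 5 ≤ ell D := five_le_ell hD5
  set L : ℝ := ell D with hLdef
  set W : Finset ℕ := (Finset.Ico 1 ⌈Skeleton.P1 D * etaPM D 1⌉₊).filter
    (fun n : ℕ => bigP D ^ (0.5 : ℝ) * etaPM D (-1) < n ∧ (n : ℝ) < Skeleton.P1 D * etaPM D 1) with hW
  set T : ℕ → ℂ := fun n => pc χ x n * (n : ℂ) ^ (-(s + beta6 D)) *
    ((gW D (bigP D ^ z / (n : ℝ)) - gW D (bigP D ^ (0.5 : ℝ) / (n : ℝ)) : ℝ) : ℂ) with hT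
  have hsum : Summable T := summable_dTerm χ x hD hs hz2
  set g : ℕ → ℂ := fun n => if n ∈ W then 0 else T n with hg_def
  have hfin : Summable fun n : ℕ => if n ∈ W then T n else 0 :=
    summable_of_ne_finset_zero (s := W) (by intro n hn; simp [hn])
  have hg : Summable g := by
    refine (hsum.sub hfin).congr fun n => ?_
    by_cases h : n ∈ W <;> simp [hg_def, h]
  have hsplit : ∑' n : ℕ, T n = (∑ n ∈ W, T n) + ∑' n : ℕ, g n := by
    have h1 : ∀ n : ℕ, T n = (if n ∈ W then T n else 0) + g n := by
      intro n; by_cases h : n ∈ W <;> simp [hg_def, h]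
    rw [tsum_congr h1, hfin.tsum_add hg, tsum_eq_sum (s := W) (by intro n hn; simp [hn])]
    congr 1
    exact Finset.sum_congr rfl fun n hn => by simp [hn]
  have hMsum : HasSum (fun n : ℕ => Real.exp (-(L ^ 10 / 2)) * (1 / (n : ℝ) ^ 2))
      (Real.exp (-(L ^ 10 / 2)) * (π ^ 2 / 6)) := hasSum_zeta_two.mul_left _
  have hg_le : ‖∑' n : ℕ, g n‖ ≤ Real.exp (-(L ^ 10 / 2)) * (π ^ 2 / 6) := by
    refine norm_tsum_le_of_hasSum hMsum fun n => ?_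
    by_cases h : n ∈ W
    · simp only [hg_def, h, if_true, norm_zero]; positivity
    · rcases Nat.eq_zero_or_pos n with rfl | hn
      · simp [hg_def, h, hT]
      · simp only [hg_def, h, if_false, hT]
        exact norm_dTerm_le_off_window χ x hL5 hs hn h hz1 hz2
  rw [hsplit, sub_add_cancel_left, norm_neg]
  exact hg_le.trans (zeta_two_mul_exp_le L)

end Literature.NumberTheory.LFunctions.Zhang2022.Section12Htilde15AFE
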